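import Mathlib
import Summits.Ventures.HodgeRepro.Tier4.Line4.FinNVGlue
import Summits.Ventures.HodgeRepro.Tier4.Line4.TorusFinSplitHaar
import Summits.Ventures.HodgeRepro.Tier4.Line4.LevelFibreCompact

/-!
# Tier4/Line4/FinNVInstance — C-L4-FINNV-GLUE (b): (S-FIN-NV) in norm form as ONE name for the (7b) assembly — the
`p`-split Haar data drawn inside, at the product domain `torusFinSplit⁻¹(univ ×ˢ DA)` of record

Blind re-derivation cell `pub-hodge-repro`, Tier 4 «prove the step» (README §9–§10), LINE L4, seat t4-L4-x2 (g0; L2-p2 g5's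
YES S15931 to the offer S15923 (a)).  Tree path `lean/Summits/Ventures/HodgeRepro/Tier4/Line4/FinNVInstance.lean`.  Imports this
seat's FinNVGlue (`finnv_of_pPhase_of_split_plain`), L2-p1's TorusFinSplitHaar (`exists_smul_map_prod_eq_fin`,
`exists_smul_map_prod_eq_fin'`) and L4-p1's LevelFibreCompact (`exists_compact_suppSet_cut_subset_of_isLinRegular`, the
fibre-compactness pair of PHASE-AT-P from PROPER + ZDOMAIN-EX (iv)).  Mathlib-level; no literature.

`finnv_of_displays` = `finnv_of_pPhase_of_split_plain` with (i) the `Z(k)`-domain of record `DZ_f := torusFinSplit⁻¹(univ ×ˢ DA)`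
(AwayDomain's product domain: `DZ_S = T_S`, `DZ^{(S)} = DA`; the glue's domain and the product domain COINCIDE, so `hfd' := hfd`),
(ii) the Haar measures `ν_S`, `ν′_S` on the `S`-tori chosen inside (`Measure.haar`) and the normalisations `c`, `c′` DRAWN
from Haar uniqueness (`exists_smul_map_prod_eq_fin`, `…_fin'`), (iii) the away measures `ν_A`, `ν′_A` free (the display
`awayOrbital ≠ 0` is stated at them).  What the (7b) assembly supplies BY NAME: `hv` ((S-UNIT), L2-p2's
`suppMeasure_toReal_pos_of_beta`), `hint`/`hB` (`ChainInputs`' `hIfin`/`hB` at each level), `DA`/`hfd` (AwayDomain); what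
stays DISPLAYED: `haway` (the away point of the `γ₀`-existence display) and the fibre-compactness pair `C`/`hsub` of
PHASE-AT-P (L4-p1 g5's item) — and `finnv_of_displays'` discharges the latter BY NAME (LevelFibreCompact) from `hdet`, `hg`,
`hlin` and the ZDOMAIN-EX (iv) clause `hDZc` of the product domain, so that the residual of (S-FIN-NV) is the display
`haway` alone (plus the assembly's own `hv` / `hint` / `hB`).

Nothing here says anything about the status of the Hodge conjecture for CM abelian varieties, which is NOT proved
(HC_CM is NOT proved by anyone in this repository).
-/

set_option autoImplicit false

noncomputable section

namespace Summit.Ventures.HodgeRepro.Tier4.Line4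

open Summit.Ventures.HodgeRepro.Tier4 Summit.Ventures.HodgeRepro.Tier4.Common
  Summit.Ventures.HodgeRepro.Tier4.Line1 NumberField IsDedekindDomain MeasureTheory

open scoped NumberField ComplexConjugate NNReal ENNReal Pointwise

section Instance

variable {k : Type} [Field k] [NumberField k] (W : PlaneData k) [MeasurableSpace (GA W)] [BorelSpace (GA W)]
  (R : RTFData W)

/-- **(S-FIN-NV) IN NORM FORM, ONE NAME FOR THE ASSEMBLY**: at the product `Z(k)`-domain `torusFinSplit⁻¹(univ ×ˢ DA)` of
record, with the `S`-Haar measures chosen inside and the normalisations drawn from Haar uniqueness — the residual binders are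
the display `haway` (at the free away measures `νA`, `νA'`), PHASE-AT-P's fibre-compactness pair `C`/`hsub`, and the
assembly's own `hv` / `hint` / `hB`. -/
theorem finnv_of_displays (hc : Continuous R.chi) (hu : ∀ a, ‖R.chi a‖ = 1) (hc' : Continuous R.chi')
    (hu' : ∀ a, ‖R.chi' a‖ = 1)
    (γ₀ : rationalPoints W) (hlin : IsLinRegular W γ₀) (p n₁ : ℕ) (hp : p ≠ 0)
    (νf : Measure (torusFin W)) [νf.IsHaarMeasure] (νf' : Measure (torusFin' W)) [νf'.IsHaarMeasure]
    (νA : Measure (torusFinAway W (placesAbove (k := k) p))) [νA.IsHaarMeasure]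
    (νA' : Measure (torusFinAway' W (placesAbove (k := k) p))) [νA'.IsHaarMeasure]
    (DA : Set (torusFinAway W (placesAbove (k := k) p))) (hDA : MeasurableSet DA)
    (hfd : IsFundamentalDomain (centreFin W)
      ((torusFinSplit W (placesAbove (k := k) p)) ⁻¹' (Set.univ ×ˢ DA)) νf)
    (C : Set (torusFin W × torusFin' W)) (hC : IsCompact C)
    (hsub : ∀ N ≥ n₁, ∀ q ∈ suppSet W (γ₀ : GA W) (p ^ N) (γ₀ : GA W),
      q.1 ∈ (torusFinSplit W (placesAbove (k := k) p)) ⁻¹' (Set.univ ×ˢ DA) → q ∈ C)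
    (haway : awayOrbital W (placesAbove (k := k) p) R (γ₀ : GA W) νA νA' DA ≠ 0)
    (hv : ∀ M : ℕ, 0 < (suppMeasure W νf νf' (γ₀ : GA W)
      ((torusFinSplit W (placesAbove (k := k) p)) ⁻¹' (Set.univ ×ˢ DA)) (p ^ M) (γ₀ : GA W)).toReal)
    (hint : ∀ M : ℕ, IntegrableOn (fun b : torusFin W =>
      R.chi b * innerFin W R (levelDC W (γ₀ : GA W) (p ^ M)) (γ₀ : GA W) νf' b)
      ((torusFinSplit W (placesAbove (k := k) p)) ⁻¹' (Set.univ ×ˢ DA)) νf)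
    (hB : ∀ (M : ℕ) (t : torusT W), Integrable (fun b' : torusFin' W => conj (R.chi' b') *
      levelDC W (γ₀ : GA W) (p ^ M)
        ((GA.ofFinPart W t)⁻¹ * GA.ofFinPart W (γ₀ : GA W) * ((b' : torusT' W) : GA W))) νf') :
    ∃ δ : ℝ, 0 < δ ∧ ∃ M₀ : ℕ, ∀ M ≥ M₀,
      δ * (suppMeasure W νf νf' (γ₀ : GA W)
        ((torusFinSplit W (placesAbove (k := k) p)) ⁻¹' (Set.univ ×ˢ DA)) (p ^ M) (γ₀ : GA W)).toReal ≤
        ‖∫ b in (torusFinSplit W (placesAbove (k := k) p)) ⁻¹' (Set.univ ×ˢ DA),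
          R.chi b * innerFin W R (levelDC W (γ₀ : GA W) (p ^ M)) (γ₀ : GA W) νf' b ∂νf‖ := by
  haveI := t2Space_GA W
  haveI : BorelSpace (torusT W) := Subtype.borelSpace _
  haveI : BorelSpace (torusT' W) := Subtype.borelSpace _
  haveI : BorelSpace (torusFin W) := Subtype.borelSpace _
  haveI : BorelSpace (torusFin' W) := Subtype.borelSpace _
  haveI : BorelSpace (torusFinAt W (placesAbove (k := k) p)) := Subtype.borelSpace _
  haveI : BorelSpace (torusFinAt' W (placesAbove (k := k) p)) := Subtype.borelSpace _
  haveI := locallyCompact_torusFinAt W (placesAbove (k := k) p)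
  haveI := locallyCompact_torusFinAt' W (placesAbove (k := k) p)
  -- the `S`-Haar measures, chosen
  obtain ⟨c, hc0, hcν⟩ := exists_smul_map_prod_eq_fin W (placesAbove (k := k) p) νf
    (Measure.haar : Measure (torusFinAt W (placesAbove (k := k) p))) νA
  obtain ⟨c', hc0', hcν'⟩ := exists_smul_map_prod_eq_fin' W (placesAbove (k := k) p) νf'
    (Measure.haar : Measure (torusFinAt' W (placesAbove (k := k) p))) νA'
  have hDZf : MeasurableSet ((torusFinSplit W (placesAbove (k := k) p)) ⁻¹' (Set.univ ×ˢ DA)) :=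
    measurableSet_preimage_torusFinSplit_prod W (placesAbove (k := k) p) MeasurableSet.univ hDA
  exact finnv_of_pPhase_of_split_plain W R hc hu hc' hu' γ₀ hlin p n₁ hp νf νf' Measure.haar νA c hc0 hcν
    Measure.haar νA' c' hc0' hcν' _ hDZf hfd Set.univ MeasurableSet.univ DA hDA hfd C hC hsub haway hv hint hB

/-- **(S-FIN-NV) with PHASE-AT-P's fibre compactness discharged by name** (L4-p1's LevelFibreCompact from PROPER +
ZDOMAIN-EX (iv)): the residual is the display `haway` alone, besides the assembly's `hv` / `hint` / `hB`. -/
theorem finnv_of_displays' (hc : Continuous R.chi) (hu : ∀ a, ‖R.chi a‖ = 1) (hc' : Continuous R.chi')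
    (hu' : ∀ a, ‖R.chi' a‖ = 1) (hdet : W.B.det ≠ 0) (hg : IsGenuineRow W)
    (γ₀ : rationalPoints W) (hlin : IsLinRegular W γ₀) (p : ℕ) (hp : p ≠ 0)
    (νf : Measure (torusFin W)) [νf.IsHaarMeasure] (νf' : Measure (torusFin' W)) [νf'.IsHaarMeasure]
    (νA : Measure (torusFinAway W (placesAbove (k := k) p))) [νA.IsHaarMeasure]
    (νA' : Measure (torusFinAway' W (placesAbove (k := k) p))) [νA'.IsHaarMeasure]
    (DA : Set (torusFinAway W (placesAbove (k := k) p))) (hDA : MeasurableSet DA)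
    (hfd : IsFundamentalDomain (centreFin W)
      ((torusFinSplit W (placesAbove (k := k) p)) ⁻¹' (Set.univ ×ˢ DA)) νf)
    (hDZc : ∀ C : Set (torusFin W), IsCompact C → IsCompact (closure
      (((torusFinSplit W (placesAbove (k := k) p)) ⁻¹' (Set.univ ×ˢ DA)) ∩ (C * (ZfIn W : Set (torusFin W))))))
    (haway : awayOrbital W (placesAbove (k := k) p) R (γ₀ : GA W) νA νA' DA ≠ 0)
    (hv : ∀ M : ℕ, 0 < (suppMeasure W νf νf' (γ₀ : GA W)
      ((torusFinSplit W (placesAbove (k := k) p)) ⁻¹' (Set.univ ×ˢ DA)) (p ^ M) (γ₀ : GA W)).toReal)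
    (hint : ∀ M : ℕ, IntegrableOn (fun b : torusFin W =>
      R.chi b * innerFin W R (levelDC W (γ₀ : GA W) (p ^ M)) (γ₀ : GA W) νf' b)
      ((torusFinSplit W (placesAbove (k := k) p)) ⁻¹' (Set.univ ×ˢ DA)) νf)
    (hB : ∀ (M : ℕ) (t : torusT W), Integrable (fun b' : torusFin' W => conj (R.chi' b') *
      levelDC W (γ₀ : GA W) (p ^ M)
        ((GA.ofFinPart W t)⁻¹ * GA.ofFinPart W (γ₀ : GA W) * ((b' : torusT' W) : GA W))) νf') :
    ∃ δ : ℝ, 0 < δ ∧ ∃ M₀ : ℕ, ∀ M ≥ M₀,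
      δ * (suppMeasure W νf νf' (γ₀ : GA W)
        ((torusFinSplit W (placesAbove (k := k) p)) ⁻¹' (Set.univ ×ˢ DA)) (p ^ M) (γ₀ : GA W)).toReal ≤
        ‖∫ b in (torusFinSplit W (placesAbove (k := k) p)) ⁻¹' (Set.univ ×ˢ DA),
          R.chi b * innerFin W R (levelDC W (γ₀ : GA W) (p ^ M)) (γ₀ : GA W) νf' b ∂νf‖ := by
  obtain ⟨C, hC, hsub⟩ := exists_compact_suppSet_cut_subset_of_isLinRegular W hdet hg γ₀ hlin
    ((torusFinSplit W (placesAbove (k := k) p)) ⁻¹' (Set.univ ×ˢ DA)) hDZc hp 0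
  exact finnv_of_displays W R hc hu hc' hu' γ₀ hlin p 0 hp νf νf' νA νA' DA hDA hfd C hC hsub haway hv hint hB

end Instance

end Summit.Ventures.HodgeRepro.Tier4.Line4

end
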